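import Literature.NumberTheory.LFunctions.WeilTwoPrimeOddMarginHBase
import Literature.NumberTheory.LFunctions.WeilBlockRowsPZ
import HarnessLib

/-!
# Two-prime odd-margin certificate H: the factored inverse agrees with `D`, rows 64–67

`WeilCert.checkDnRow` for certificate H, by `decide +kernel`. Pure proof file.
-/

noncomputable section

namespace Literature.NumberTheory.LFunctions

set_option maxHeartbeats 0 in
/-- Row 64 of `Dn/Ls` is row 64 of `D` (certificate H). [folklore] -/
theorem checkDnRow1_64_weilCert23H : weilCert23HBase.checkDnRow weilCert23HDn weilCert23HLs 1 64 = true := by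
  decide +kernel

set_option maxHeartbeats 0 in
/-- Row 65 of `Dn/Ls` is row 65 of `D` (certificate H). [folklore] -/
theorem checkDnRow1_65_weilCert23H : weilCert23HBase.checkDnRow weilCert23HDn weilCert23HLs 1 65 = true := by
  decide +kernel

set_option maxHeartbeats 0 in
/-- Row 66 of `Dn/Ls` is row 66 of `D` (certificate H). [folklore] -/
theorem checkDnRow1_66_weilCert23H : weilCert23HBase.checkDnRow weilCert23HDn weilCert23HLs 1 66 = true := by
  decide +kernel

set_option maxHeartbeats 0 in
/-- Row 67 of `Dn/Ls` is row 67 of `D` (certificate H). [folklore] -/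
theorem checkDnRow1_67_weilCert23H : weilCert23HBase.checkDnRow weilCert23HDn weilCert23HLs 1 67 = true := by
  decide +kernel


end Literature.NumberTheory.LFunctions
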